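import Mathlib
import Summits.NavierStokesRegularity.NavierStokesRegularity.Theorems.TaoLadderRungTwoFlatLinearisedGronwall
import HarnessLib

/-!
# Picard–Gronwall for infinite systems with uniformly bounded local coupling (abstract form)
  (helper for item stmt-NavierStokesRegularity-22987 `FlatGapCertificatesV2`, crux K_A♭ of route
  TaoLadderRungTwoFlat; cell harvest/h2-tao-ladder, p1 g19)

The Gronwall bounds of `…LinearisedGronwall` / `…ForcedGronwall` only use ONE property of the lattice
equation: at each time, a UNIFORM bound `m` on all components `|u_j(t)|` yields the bound `K·m + F` on every
derivative `|u̇_i(t)|`. This file records the abstract statement over an ARBITRARY index type `ι` (e.g.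
`Fin 2 × ℤ`, or the same after a GAUGE change `ũ_i = ω_i u_i` — the weighted sup norms of the transfer plan,
LADDER §47.3, where `K = 2‖α‖₁ M · sup ω_k/ω_{k±1}`):

* `IsLocallyDominated K F T u d` — the coupling hypothesis: on `[0,T]`, `(∀ j, |u j t| ≤ m) → |d i t| ≤ K m + F`
  for every `m ≥ 0`;
* `abs_le_majorant_abstract` — Picard majorants `(B + F s)·Σ_{l<j}(Ks)^l/l! + M_u (Ks)^j/j!`;
* `abs_le_exp_abstract` — **`|u_i(s)| ≤ (B + F s)·exp(K s)`** on `[0, T]` for a family bounded by `M_u` on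
  `[0, T]` with `|u_i(0)| ≤ B`, `HasDerivAt (u i) (d i t) t`, `d i` continuous.

HONEST FRAMING: elementary real analysis; nothing specific to any lattice is asserted; nothing about the
Navier–Stokes equations.
-/

noncomputable section

-- the sub-problem namespace repeats the summit name by design (D-0017)
set_option linter.dupNamespace false

namespace Summit.NavierStokesRegularity.NavierStokesRegularity.Theorems

open Set Filter
open scoped Topology Nat

namespace LatticeGronwall

variable {ι : Type*}

/-- **Uniformly bounded local coupling with forcing**: on `[0, T]`, any uniform bound `m ≥ 0` of the family at
time `t` bounds every derivative by `K m + F`. [folklore] -/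
def IsLocallyDominated (K F T : ℝ) (u d : ι → ℝ → ℝ) : Prop :=
  ∀ t ∈ Icc 0 T, ∀ m : ℝ, 0 ≤ m → (∀ j, |u j t| ≤ m) → ∀ i, |d i t| ≤ K * m + F

/-- **Abstract Picard majorants.** [folklore] -/
theorem abs_le_majorant_abstract {K F T Mu B : ℝ} {u d : ι → ℝ → ℝ} (hK : 0 ≤ K) (hF : 0 ≤ F)
    (hdom : IsLocallyDominated K F T u d) (hder : ∀ i t, HasDerivAt (u i) (d i t) t)
    (hdc : ∀ i, Continuous (d i)) (hbdd : ∀ i, ∀ t ∈ Icc 0 T, |u i t| ≤ Mu) (hB : ∀ i, |u i 0| ≤ B) :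
    ∀ (j : ℕ) (i : ι), ∀ s ∈ Icc 0 T,
      |u i s| ≤ (B + F * s) * ∑ l ∈ Finset.range j, (K * s) ^ l / l ! + Mu * (K * s) ^ j / j ! := by
  intro j
  induction j with
  | zero =>
    intro i s hs
    simpa using hbdd i s hs
  | succ j ih =>
    intro i s hs
    have hs0 : 0 ≤ s := hs.1
    have hMu : 0 ≤ Mu := (abs_nonneg _).trans (hbdd i 0 ⟨le_rfl, hs0.trans hs.2⟩)
    have hB0 : 0 ≤ B := (abs_nonneg _).trans (hB i)
    have hftc : ∫ σ in (0 : ℝ)..s, d i σ = u i s - u i 0 :=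
      intervalIntegral.integral_eq_sub_of_hasDerivAt (fun σ _ => hder i σ) ((hdc i).intervalIntegrable _ _)
    have hpt : ∀ σ ∈ Icc 0 s, |d i σ| ≤
        F + K * ((B + F * s) * ∑ l ∈ Finset.range j, (K * σ) ^ l / l ! + Mu * (K * σ) ^ j / j !) := by
      intro σ hσ
      have hσT : σ ∈ Icc 0 T := ⟨hσ.1, hσ.2.trans hs.2⟩
      have hsum0 : 0 ≤ ∑ l ∈ Finset.range j, (K * σ) ^ l / (l ! : ℝ) :=
        Finset.sum_nonneg fun l _ => by have := hσ.1; positivity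
      have hm0 : 0 ≤ (B + F * σ) * ∑ l ∈ Finset.range j, (K * σ) ^ l / l ! + Mu * (K * σ) ^ j / j ! := by
        have := hσ.1; positivity
      have hb := hdom σ hσT _ hm0 (fun j' => ih j' σ hσT) i
      have hmono : (B + F * σ) * ∑ l ∈ Finset.range j, (K * σ) ^ l / l ! ≤
          (B + F * s) * ∑ l ∈ Finset.range j, (K * σ) ^ l / l ! :=
        mul_le_mul_of_nonneg_right (by nlinarith [hσ.2]) hsum0
      nlinarith [mul_le_mul_of_nonneg_left hmono hK]
    have hmaj2 : Continuous fun σ : ℝ =>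
        K * ((B + F * s) * ∑ l ∈ Finset.range j, (K * σ) ^ l / l ! + Mu * (K * σ) ^ j / j !) := by
      refine continuous_const.mul (Continuous.add ?_ ?_)
      · exact continuous_const.mul (continuous_finsetSum _ fun l _ =>
          ((continuous_const.mul continuous_id).pow l).div_const _)
      · exact (continuous_const.mul ((continuous_const.mul continuous_id).pow j)).div_const _
    have hmaj_cont : Continuous fun σ : ℝ =>
        F + K * ((B + F * s) * ∑ l ∈ Finset.range j, (K * σ) ^ l / l ! + Mu * (K * σ) ^ j / j !) :=
      continuous_const.add hmaj2
    have hI : ∫ σ in (0 : ℝ)..s,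
        (F + K * ((B + F * s) * ∑ l ∈ Finset.range j, (K * σ) ^ l / l ! + Mu * (K * σ) ^ j / j !)) =
        F * s + ((B + F * s) * ∑ l ∈ Finset.range j, (K * s) ^ (l + 1) / (l + 1)! +
          Mu * (K * s) ^ (j + 1) / (j + 1)!) := by
      rw [intervalIntegral.integral_add intervalIntegrable_const (hmaj2.intervalIntegrable _ _),
        intervalIntegral.integral_const, QuadPolar.integral_majorant, smul_eq_mul, sub_zero, mul_comm s F]
    have hu_eq : u i s = u i 0 + ∫ σ in (0 : ℝ)..s, d i σ := by rw [hftc]; ring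
    calc |u i s| = |u i 0 + ∫ σ in (0 : ℝ)..s, d i σ| := by rw [← hu_eq]
      _ ≤ |u i 0| + |∫ σ in (0 : ℝ)..s, d i σ| := abs_add_le _ _
      _ ≤ B + ∫ σ in (0 : ℝ)..s, |d i σ| := add_le_add (hB i) (intervalIntegral.abs_integral_le_integral_abs hs0)
      _ ≤ B + ∫ σ in (0 : ℝ)..s,
            (F + K * ((B + F * s) * ∑ l ∈ Finset.range j, (K * σ) ^ l / l ! + Mu * (K * σ) ^ j / j !)) := by
          gcongr
          exact intervalIntegral.integral_mono_on hs0 (((hdc i).abs).intervalIntegrable _ _)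
            (hmaj_cont.intervalIntegrable _ _) hpt
      _ = B + (F * s + ((B + F * s) * ∑ l ∈ Finset.range j, (K * s) ^ (l + 1) / (l + 1)! +
            Mu * (K * s) ^ (j + 1) / (j + 1)!)) := by rw [hI]
      _ = (B + F * s) * ∑ l ∈ Finset.range (j + 1), (K * s) ^ l / l ! + Mu * (K * s) ^ (j + 1) / (j + 1)! := by
          rw [Finset.sum_range_succ' (fun l => (K * s) ^ l / (l ! : ℝ))]
          simp only [pow_zero, Nat.factorial_zero, Nat.cast_one, div_one]
          ring

/-- **ABSTRACT GRONWALL**: `|u_i(s)| ≤ (B + F s)·exp(K s)` on `[0, T]` under uniformly bounded local coupling with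
forcing, for a family bounded on `[0, T]` with continuous derivatives. [folklore] -/
theorem abs_le_exp_abstract {K F T Mu B : ℝ} {u d : ι → ℝ → ℝ} (hK : 0 ≤ K) (hF : 0 ≤ F)
    (hdom : IsLocallyDominated K F T u d) (hder : ∀ i t, HasDerivAt (u i) (d i t) t)
    (hdc : ∀ i, Continuous (d i)) (hbdd : ∀ i, ∀ t ∈ Icc 0 T, |u i t| ≤ Mu) (hB : ∀ i, |u i 0| ≤ B) (i : ι)
    {s : ℝ} (hs : s ∈ Icc 0 T) : |u i s| ≤ (B + F * s) * Real.exp (K * s) := by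
  set x := K * s with hx
  have hx0 : 0 ≤ x := by rw [hx]; have := hs.1; positivity
  have hB0 : 0 ≤ B + F * s := by have := (abs_nonneg _).trans (hB i); have := hs.1; positivity
  have hmaj : ∀ j : ℕ, |u i s| ≤ (B + F * s) * Real.exp x + Mu * x ^ j / j ! := by
    intro j
    have h := abs_le_majorant_abstract hK hF hdom hder hdc hbdd hB j i s hs
    have hsum : (B + F * s) * ∑ l ∈ Finset.range j, x ^ l / l ! ≤ (B + F * s) * Real.exp x :=
      mul_le_mul_of_nonneg_left (Real.sum_le_exp_of_nonneg hx0 j) hB0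
    rw [← hx] at h
    linarith
  have hlim : Tendsto (fun j : ℕ => (B + F * s) * Real.exp x + Mu * x ^ j / j !) atTop
      (𝓝 ((B + F * s) * Real.exp x)) := by
    have h := (Real.summable_pow_div_factorial x).tendsto_atTop_zero
    have h2 := (h.const_mul Mu).const_add ((B + F * s) * Real.exp x)
    rw [mul_zero, add_zero] at h2
    refine h2.congr fun j => ?_
    ring
  exact ge_of_tendsto' hlim hmaj

/-- **Gauge form**: if `ũ_i = ω_i u_i` satisfies the domination hypothesis with constant `K` (e.g. a nearest-neighbour
coupling with neighbour weight ratios `≤ G` gives `K = K₀ G`), the weighted bound `ω_i |u_i(s)| ≤ (B + F s) e^{Ks}`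
follows. (Restatement of `abs_le_exp_abstract` for the rescaled family; recorded for the transfer plan's gauges.)
[folklore] -/
theorem weighted_abs_le_exp {K F T Mu B : ℝ} {u d : ι → ℝ → ℝ} {ω : ι → ℝ} (hK : 0 ≤ K) (hF : 0 ≤ F)
    (hdom : IsLocallyDominated K F T (fun i t => ω i * u i t) (fun i t => ω i * d i t))
    (hder : ∀ i t, HasDerivAt (u i) (d i t) t) (hdc : ∀ i, Continuous (d i))
    (hbdd : ∀ i, ∀ t ∈ Icc 0 T, |ω i * u i t| ≤ Mu) (hB : ∀ i, |ω i * u i 0| ≤ B) (i : ι) {s : ℝ}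
    (hs : s ∈ Icc 0 T) : |ω i * u i s| ≤ (B + F * s) * Real.exp (K * s) :=
  abs_le_exp_abstract hK hF hdom (fun i t => (hder i t).const_mul (ω i)) (fun i => continuous_const.mul (hdc i))
    hbdd hB i hs

end LatticeGronwall

end Summit.NavierStokesRegularity.NavierStokesRegularity.Theorems

end
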